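import Summits.BirchSwinnertonDyer.BirchSwinnertonDyer.Theses.ShaPrimaryTransfer
import Summits.BirchSwinnertonDyer.BirchSwinnertonDyer.Theorems.SelmerRankShaCorank
import Summits.BirchSwinnertonDyer.BirchSwinnertonDyer.Theorems.Rank1ResidualX5TwoDefs
import Literature.NumberTheory.EllipticCurves.LeadingTerm
import Literature.NumberTheory.EllipticCurves.SelmerCorankHolds
import Literature.NumberTheory.EllipticCurves.BSDSelmerCMPConverse

/-!
# BirchSwinnertonDyer / ShaPrimaryTransfer — crux `FiniteShaComponentTransfer` (stmt-BirchSwinnertonDyer-22356):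
# the DOOR AT 2 in algebraic rank ≤ 1 is downstream of the registered 2-converse leaf

Route `ShaPrimaryTransfer` (D-0145 LINE 2) opens its door by complete 2-descent: a curve with `t_2(E) =
corank_{ℤ_2} Ш(E)[2^∞] = 0` certified, to be transferred (crux T) to the good ordinary prime of X3. The companion
file `…Sectors` shows that this transfer is in print only for CM curves of rank `0` (Burungale–Tian 2026, door at
any prime), and names as the residue at the cell's prime `p = 2` the **rank-`≤ 1` 2-converse for non-CM curves**.
That residue is already a REGISTERED object of the tree: the rung leaf
`Summit.BirchSwinnertonDyer.BirchSwinnertonDyer.Rank1Residual.NonCMTwoConverse` (`@[conjecture]`, OPEN; target of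
route `TwoAdicConverse`, whose items `GoodOrdinaryRankZeroTwoConverse` (stmt-19218),
`MultiplicativeRankZeroTwoConverse` (stmt-19219), `RankOneTwoConverse` (stmt-19220) assemble it): for non-CM `E`
with good ordinary or multiplicative reduction at `2` and `r ≤ 1`, `corank Sel_{2^∞}(E/ℚ) = r ⟹ ord_{s=1} L(E,s) = r`.
This helper file (prover seat `bsd-line-spt-p1`, `--supports stmt-22356 --as helper`) lands, by name:

* `transfer_doorAtTwo_of_nonCMTwoConverse` — granting `NonCMTwoConverse` and Gross–Zagier–Kolyvagin (`hGZK`), the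
  door at `2` transfers to EVERY prime for non-CM curves of rank `≤ 1` that are ordinary or multiplicative at `2`
  (on a global minimal model): `t_2 = 0` makes `corank Sel_{2^∞} = rank ≤ 1` (Greenberg's identity, tree theorem),
  the 2-converse gives `ord_{s=1} L(E,s) = rank ≤ 1`, GZK makes `Ш(E/ℚ)` finite.
* `transfer_doorAtTwo_rank_le_one` — the same with the CM case adjoined at rank `0` (Burungale–Tian 2026 Thm. 1.1,
  `hBT0`, any prime, so in particular the door at `2`).

So, in the cell's coordinates (p = 2), the slice of T that the route actually exercises at rank ≤ 1 is NOT new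
content: it is implied by the registered leaf `NonCMTwoConverse` (+ GZK, + BT2026 for CM rank 0); what T adds
beyond registered items at the door `2` is (i) rank ≥ 2, (ii) rank ≤ 1 at curves supersingular or additive at `2`,
(iii) CM rank 1. CONDITIONAL on the named hypotheses; nothing here proves T, `NonCMTwoConverse`, or BSD.

References: A. Smith, arXiv:2503.17619 (2025), Thm. 1.1 (the 2-converse as an input); D. Kriz, C. Li, arXiv:1606.03172,
§1 p. 3 («the p-converse … for p = 2 is not known»); A. Burungale, Y. Tian, Ann. of Math. 203 (2026), Thm. 1.1;
R. Greenberg, LNM 1716 (1999), §1; V. Kolyvagin (1990), Thm. A.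
-/

-- D-0017: single-problem summit, so `Summit.BirchSwinnertonDyer.BirchSwinnertonDyer.…` repeats a namespace BY DESIGN.
set_option linter.dupNamespace false

noncomputable section

namespace Summit.BirchSwinnertonDyer.BirchSwinnertonDyer.Theorems.ShaPrimaryTransferDoorAtTwo

open scoped Classical
open Literature.NumberTheory.EllipticCurves Literature.NumberTheory.EllipticCurves.Rank1Residual
open WeierstrassCurve
open Summit.BirchSwinnertonDyer.BirchSwinnertonDyer.Rank1Residual (NonCMTwoConverse)

/-- **The door at 2 transfers for non-CM curves of rank ≤ 1, ordinary or multiplicative at 2 — granting the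
registered 2-converse leaf and GZK.** For `W/ℚ` elliptic on a global minimal model, non-CM, with good ordinary or
multiplicative reduction at `2`, `rank E(ℚ) ≤ 1` and `corank_{ℤ_2} Ш(E)[2^∞] = 0`: every `corank_{ℤ_q} Ш(E)[q^∞]`
vanishes. Proof: `corank Sel_{2^∞} = rank + t_2 = rank` (Greenberg LNM 1716 §1, tree theorem
`selmerCorank_eq_mordellWeilRank_add_holds`); `NonCMTwoConverse` at `r = rank` gives `ord_{s=1} L(E,s) = rank ≤ 1`;
Gross–Zagier–Kolyvagin (`hGZK`, named fact `rank_eq_analyticRank_of_analyticRank_le_one`) makes `Ш(E/ℚ)` finite, and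
a finite `q`-primary group has corank `0` (`Literature.BSD.shaCorank_eq_zero_of_finite`). CONDITIONAL on `h2`, `hGZK`.
[cite: arXiv250317619, Thm. 1.1 (2-converse input)] [cite: Greenberg1999LNM, §1 pp. 54–57] [cite: Kolyvagin1990, Thm. A] -/
theorem transfer_doorAtTwo_of_nonCMTwoConverse (h2 : NonCMTwoConverse)
    (hGZK : rank_eq_analyticRank_of_analyticRank_le_one)
    (W : WeierstrassCurve ℚ) [W.IsElliptic] [W.IsGloballyMinimal] (hncm : ¬ W.HasCM)
    (hred : GoodOrd W 2 ∨ Mult W 2) (hr : W.mordellWeilRank ≤ 1) (q : ℕ) [Fact q.Prime]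
    (h0 : W.shaCorank 2 = 0) : W.shaCorank q = 0 := by
  have hs : W.selmerCorank 2 = W.mordellWeilRank := by
    rw [W.selmerCorank_eq_mordellWeilRank_add_holds 2, h0, add_zero]
  have ha : W.analyticRank = W.mordellWeilRank := h2 W hncm hred W.mordellWeilRank hr hs
  haveI : Finite ↥W.sha := (hGZK W (by omega)).2
  exact Literature.BSD.shaCorank_eq_zero_of_finite W q
    (inferInstance : Finite ↥(AddCommGroup.primaryComponent W.sha q))

/-- **The door at 2 in rank ≤ 1, CM case adjoined at rank 0.** As above, or `W` has CM and rank `0` (then any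
door prime works, Burungale–Tian 2026 Thm. 1.1 `hBT0`: `corank Sel_{p^∞} = 0 ⟹ L(E,1) ≠ 0` for CM curves at every
prime). What is NOT covered at the door `2` in rank ≤ 1: non-CM curves supersingular or additive at `2`, and CM
curves of rank `1` — no registered item or printed theorem. CONDITIONAL on `h2`, `hBT0`, `hGZK`.
[cite: BurungaleTian2026, Thm. 1.1] [cite: arXiv250317619, Thm. 1.1 (2-converse input)] [cite: Kolyvagin1990, Thm. A] -/
theorem transfer_doorAtTwo_rank_le_one (h2 : NonCMTwoConverse)
    (hBT0 : burungaleTian_analyticRank_eq_zero_of_selmerCorank_eq_zero_of_hasCM)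
    (hGZK : rank_eq_analyticRank_of_analyticRank_le_one)
    (W : WeierstrassCurve ℚ) [W.IsElliptic] [W.IsGloballyMinimal]
    (hsec : (¬ W.HasCM ∧ (GoodOrd W 2 ∨ Mult W 2) ∧ W.mordellWeilRank ≤ 1) ∨ (W.HasCM ∧ W.mordellWeilRank = 0))
    (q : ℕ) [Fact q.Prime] (h0 : W.shaCorank 2 = 0) : W.shaCorank q = 0 := by
  rcases hsec with ⟨hncm, hred, hr⟩ | ⟨hCM, hr0⟩
  · exact transfer_doorAtTwo_of_nonCMTwoConverse h2 hGZK W hncm hred hr q h0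
  · have hs : W.selmerCorank 2 = 0 := by
      rw [W.selmerCorank_eq_mordellWeilRank_add_holds 2, h0, hr0]
    have ha : W.analyticRank = 0 := hBT0 W hCM 2 hs
    haveI : Finite ↥W.sha := (hGZK W (by omega)).2
    exact Literature.BSD.shaCorank_eq_zero_of_finite W q
      (inferInstance : Finite ↥(AddCommGroup.primaryComponent W.sha q))

end Summit.BirchSwinnertonDyer.BirchSwinnertonDyer.Theorems.ShaPrimaryTransferDoorAtTwo
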